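import Literature.MeasureTheory.Group.InvariantQuotientPiNormalized
import Literature.NumberTheory.Automorphic.LocalOrbitalIntegrand
import Literature.NumberTheory.Automorphic.SingularOrbitalIntegralTransportWeilForm
import Literature.NumberTheory.Automorphic.ArchTorusOrbitalFubini
import Literature.NumberTheory.Automorphic.ArchStableClassRegularTorus
import HarnessLib

/-!
# A product of per-place singular orbit (Weil-quotient) integrals IS an orbital integral on the product group — and a CLASS orbital
# integral of any compatible Weil-form family («(R1-c) THE END STATE IS A CLASS ORBITAL INTEGRAL»)
(Rogawski (1990), §8.2 pp. 122–124, §14.5 pp. 238–239 — the «method of §8.2» at a split-singular `γ₀ ⊗ 1 ∈ G′_∞ = Π_w G_w`; Folland (1995), §2.6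
Thm. 2.49 ∕ (2.52); Gelbart (1975), p. 155 (10.19); Deitmar–Echterhoff (2014), Thm. 1.5.3)

Topic `NumberTheory/Rogawski1990` (the consumer is the ROAD-Sd ∕ #88 reading `stub_LuseAllPlaces`); namespaces `Literature.MeasureTheory.Group` (§1, generic
finite products) and `Literature.NumberTheory.Automorphic.UnitaryGroup` (§2, `G′_∞ = U(diag α)(L⁺ ⊗ ℝ) ≃ Π_w G_w`).  THEOREMS ONLY over accepted tree modules
(no definition, no instance, no notation, no named fact, no `sorry`).  Cell `hodgecm-mathlib`, crux H413 (`stmt-HodgeConjecture-24833`); brick (R1-c) of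
F0P3a-p07 (g7)'s census `CENSUS-R1-LuseAllPlaces` 8d436054 (LEAD F0P3a-plan (g9) T8-53∕T8-57; pen F0P3-p03 (g9), p07 «=» 04:40:39Z).  Count-neutral floor-1
glue; HC_CM is proved only modulo the printed citations until rung 0 closes.

WHAT.  After every indefinite place has been taken to the wall ((R1-b), one place at a time), the state of the «method of §8.2» is an integral of the
test function `a` against the PRODUCT over the complex places `w` of the per-place WALL ORBIT MEASURES — each the push-forward of the Weil quotient
`dν_w ∕ dρ_w` on `G_w ⧸ Z(γ_w)` along the orbit map `y Z(γ_w) ↦ y γ_w y⁻¹` (★ `descConj γ_w Z(γ_w) _ id`).  This file identifies that end state, with NO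
new Weil theory (p07's RISK (r1) is ★: the finite-`pi` Weil formula `(⨂ν_w)∕(⨂ρ_w) = ⊠(ν_w∕ρ_w)` is ★ `InvariantQuotientPiNormalized`):

* §1 GENERIC (`ι` finite; `G_i` locally compact second countable Hausdorff groups; `γ = (γ_i)`; Haar `ν_i` on `G_i`, Haar inversion-invariant `ρ_i` on
  `Z(γ_i)`, and `ρ ↔ ⨂ ρ_i` on `Π_i Z(γ_i) ≤ Π_i G_i`, the ★ binder `hρ : ρ.map (subgroupPiCoords _) = Measure.pi ρi`):
  - `mul_eq_mul_of_mem_pi_centralizer` — `Π_i Z(γ_i)` centralises `γ` (★ `centralizer_singleton_pi_eq`);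
  - `descConj_pi_quotientPiEquiv_symm` — the orbital integrand of `F` on `(Π G_i) ⧸ (Π Z(γ_i))` pulled back to `Π_i (G_i ⧸ Z(γ_i))` is
    `p ↦ F (i ↦ orbit_i (p_i))`;
  - **`integral_pi_quotientMeasure_comp_descConj_id_eq`** — `∫_{Π_i (G_i ⧸ Z_i)} F((y_i γ_i y_i⁻¹)_i) d(⊗_i (ν_i∕ρ_i)) = ∫_{(ΠG_i)⧸(ΠZ_i)} F(y γ y⁻¹) d((⨂ν_i)∕ρ)`
    (★ `integral_quotientMeasure_pi_eq_integral_pi`, any Banach-valued `F`);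
  - **`integral_pi_map_descConj_id_eq`** — the same with the per-place ORBIT MEASURES `(ν_i∕ρ_i).map orbit_i` on `G_i` (Mathlib `Measure.pi_map_pi`);
  - **`integral_pi_quotientMeasure_comp_descConj_id_eq_orbitalIntegral`** — along a bicontinuous `e : (Π_i G_i) ≃* G′` with `γ′ = e γ`, for a Haar `ν′` on
    `G′` with `ν′.map e.symm = ⨂ ν_i` and the transported centraliser measure `ρ′ = (e|_{ΠZ})_* ρ` on `Z(γ′)`:
    `∫_{Π_i (G_i ⧸ Z_i)} f(e((y_i γ_i y_i⁻¹)_i)) d(⊗_i (ν_i∕ρ_i)) = O_{γ′}(f; ν′∕ρ′)` (★ (G2a) `integral_descConj_quotientMeasure_map_symm_eq_orbitalIntegral`);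
  - **`OrbitalMeasureFamily.integral_pi_quotientMeasure_comp_descConj_id_eq_classOrbitalIntegral_of_atPoint_eq`** — `= Φ(⟦γ′⟧, f; m)` for any family `m`
    on `G′` with `m.atPoint γ′ = ν′∕ρ′` (★ (G2b); the `hq` binder is ★ p840955's ∃-PIN + ★ Haar change for the letter's singular family).
* §2 `G′_∞ = U(diag α)(L⁺ ⊗ ℝ)`, `e⁻¹ = archPiEquivCM`, torus point `γ′ = t(z) = archDiagTorus L N α z` (components `diag(z_w)`, ★ `archPiEquivCM_archDiagTorus`), the
  (V7) product-measure convention `ν = (⨂ν_w).map e⁻¹.symm` (★ (h0) Haar): **`UnitaryGroup.integral_pi_quotientMeasure_comp_conj_circleDiagonal_eq_orbitalIntegral_archDiagTorus`**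
  and **`UnitaryGroup.integral_pi_quotientMeasure_comp_conj_circleDiagonal_eq_classOrbitalIntegral_archDiagTorus_of_atPoint_eq`** — p07's end state
  `Ψ_{I,ρ}` read as `O_{t(z)}(a; ν∕ρ′)`, resp. `Φ(⟦t(z)⟧, a; m)`; no wall hypothesis is needed for the identity itself (it holds at every `z`).
NOT here: the compact-wall ∕ definite-place variant in which a factor is the HAAR push-forward `ν_w.map (y ↦ y·diag·y⁻¹)` — convert it first by ★ (G1)
`integral_comp_conj_eq_measureReal_mul_classOrbitalIntegral_of_atPoint_eq` ∕ ★ `InvariantQuotientCompactSubgroup` (`= ρ_w(Z_w) •` the quotient form).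

## References
* [Rogawski1990] J. D. Rogawski, *Automorphic Representations of Unitary Groups in Three Variables*, Ann. of Math. Stud. 123 (1990), §8.2 pp. 122–124,
  §14.5 Lemma 14.5.2 (b) pp. 238–239, §1.7 p. 6.
* [Folland1995] G. B. Folland, *A Course in Abstract Harmonic Analysis* (1995), §2.6 Thm. 2.49, (2.52).
* [Gelbart1975] S. Gelbart, *Automorphic forms on adele groups* (1975), p. 155 (10.19).
* [DeitmarEchterhoff2014] A. Deitmar, S. Echterhoff, *Principles of Harmonic Analysis*, 2nd ed. (2014), Thm. 1.5.3.
-/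

set_option autoImplicit false

noncomputable section

open MeasureTheory Measure Set
open Literature.NumberTheory.Automorphic
open scoped ENNReal NNReal

/-! ## §1 Generic finite products -/

namespace Literature.MeasureTheory.Group

section PiAlgebra

variable {ι : Type*} {G : ι → Type*} [∀ i, Group (G i)] (γ : ∀ i, G i)

/-- `Π_i Z(γ_i)` centralises `γ = (γ_i)` (cf. ★ `centralizer_singleton_pi_eq`): the `hM` binder of ★ `descConj` on the product quotient.
[cite: Gelbart1975, p. 155 (10.19)] [cite: Folland1995, §2.6 Thm. 2.49] -/
theorem mul_eq_mul_of_mem_pi_centralizer (x : ∀ i, G i)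
    (hx : x ∈ Subgroup.pi Set.univ (fun i => Subgroup.centralizer ({γ i} : Set (G i)))) : x * γ = γ * x :=
  funext fun i => Subgroup.mem_centralizer_singleton_iff.1 (hx i (Set.mem_univ i))

/-- Membership form of `e(Π_i Z(γ_i)) = Z(e γ)` for an isomorphism `e : Π_i G_i ≃* G′` (the compatibility binder of ★ `subgroupCongrHomeomorph` ∕ (G2a);
cf. ★ `InvariantQuotientOrbitalPi.forall_apply_mem_centralizer_pi_iff`, same statement). [cite: Gelbart1975, p. 155 (10.19)] -/
theorem apply_mem_centralizer_iff_mem_pi_centralizer {G' : Type*} [Group G'] (e : (∀ i, G i) ≃* G') {γ' : G'} (hγ : e γ = γ') :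
    ∀ p : ∀ i, G i, e p ∈ Subgroup.centralizer ({γ'} : Set G') ↔
      p ∈ Subgroup.pi Set.univ (fun i => Subgroup.centralizer ({γ i} : Set (G i))) := by
  intro p
  rw [← hγ, Subgroup.mem_centralizer_singleton_iff, ← map_mul, ← map_mul, e.apply_eq_iff_eq]
  refine ⟨fun h i _ => Subgroup.mem_centralizer_singleton_iff.2 ?_, fun h => ?_⟩
  · have := congrFun h i
    simpa only [Pi.mul_apply] using this.symm.symm
  · exact (mul_eq_mul_of_mem_pi_centralizer γ p h).symm.symm

/-- **The orbital integrand in product coordinates**: pulled back along `Π_i (G_i ⧸ Z(γ_i)) ≃ (Π G_i) ⧸ (Π Z(γ_i))` (★ `quotientPiEquiv`, the map of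
★ `quotientPiHomeomorph`), `y (ΠZ) ↦ F(y γ y⁻¹)` is `p ↦ F((orbit_i p_i)_i)` with `orbit_i = descConj γ_i Z(γ_i) _ id`. [cite: Gelbart1975, p. 155 (10.19)] -/
theorem descConj_pi_quotientPiEquiv_symm {α : Type*} (F : (∀ i, G i) → α) (p : ∀ i, G i ⧸ Subgroup.centralizer ({γ i} : Set (G i))) :
    descConj γ (Subgroup.pi Set.univ (fun i => Subgroup.centralizer ({γ i} : Set (G i)))) (mul_eq_mul_of_mem_pi_centralizer γ) F
        ((quotientPiEquiv (fun i => Subgroup.centralizer ({γ i} : Set (G i)))).symm p) =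
      F (fun i => descConj (γ i) (Subgroup.centralizer ({γ i} : Set (G i))) (fun _ hg => Subgroup.mem_centralizer_singleton_iff.1 hg) id (p i)) := by
  have hp : p = fun i => (QuotientGroup.mk (Quotient.out (p i)) : G i ⧸ Subgroup.centralizer ({γ i} : Set (G i))) :=
    funext fun i => (QuotientGroup.out_eq' (p i)).symm
  rw [hp, quotientPiEquiv_symm_mk, descConj_mk]
  rfl

end PiAlgebra

section PiOrbit

variable {ι : Type*} [Fintype ι] {G : ι → Type*} [∀ i, Group (G i)] [∀ i, TopologicalSpace (G i)]
  [∀ i, IsTopologicalGroup (G i)] [∀ i, LocallyCompactSpace (G i)] [∀ i, SecondCountableTopology (G i)]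
  [∀ i, T2Space (G i)] [∀ i, MeasurableSpace (G i)] [∀ i, BorelSpace (G i)]
  (γ : ∀ i, G i)

omit [Fintype ι] [∀ i, LocallyCompactSpace (G i)] [∀ i, SecondCountableTopology (G i)] [∀ i, MeasurableSpace (G i)] [∀ i, BorelSpace (G i)] in
/-- Closedness of `Π_i Z(γ_i)` (★ `isClosed_coe_pi` ∘ ★ `isClosed_coe_centralizer_singleton`). [cite: DeitmarEchterhoff2014, Lemma 9.3.3] -/
theorem isClosed_coe_pi_centralizer :
    IsClosed ((Subgroup.pi Set.univ (fun i => Subgroup.centralizer ({γ i} : Set (G i))) : Subgroup (∀ i, G i)) : Set (∀ i, G i)) :=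
  isClosed_coe_pi _ fun i => isClosed_coe_centralizer_singleton (γ i)

variable
  (ρi : ∀ i, Measure (Subgroup.centralizer ({γ i} : Set (G i)))) [∀ i, (ρi i).IsHaarMeasure] [∀ i, (ρi i).IsInvInvariant]
  (ρ : Measure (Subgroup.pi Set.univ (fun i => Subgroup.centralizer ({γ i} : Set (G i)))))
  [ρ.IsHaarMeasure] [ρ.IsInvInvariant]
  (hρ : Measure.map (subgroupPiCoords fun i => Subgroup.centralizer ({γ i} : Set (G i))) ρ = Measure.pi ρi)
  (ν : ∀ i, Measure (G i)) [∀ i, IsHaarMeasure (ν i)] [∀ i, (ν i).IsMulRightInvariant]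
  [∀ i, MeasurableSpace (G i ⧸ Subgroup.centralizer ({γ i} : Set (G i)))] [∀ i, BorelSpace (G i ⧸ Subgroup.centralizer ({γ i} : Set (G i)))]
  [MeasurableSpace ((∀ i, G i) ⧸ Subgroup.pi Set.univ (fun i => Subgroup.centralizer ({γ i} : Set (G i))))]
  [BorelSpace ((∀ i, G i) ⧸ Subgroup.pi Set.univ (fun i => Subgroup.centralizer ({γ i} : Set (G i))))]

include hρ in
/-- **PRODUCT OF PER-PLACE WEIL-QUOTIENT ORBIT INTEGRALS = ORBITAL INTEGRAL ON THE PRODUCT.**  For every Banach-valued `F` on `Π_i G_i`: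
`∫_{Π_i (G_i ⧸ Z(γ_i))} F((y_i γ_i y_i⁻¹)_i) d(⊗_i (ν_i ∕ ρ_i)) = ∫_{(Π G_i) ⧸ (Π Z(γ_i))} F(y γ y⁻¹) d((⨂ ν_i) ∕ ρ)` — ★ `integral_quotientMeasure_pi_eq_integral_pi`
(`(⨂ν_i)∕(⨂ρ_i) = ⊠(ν_i∕ρ_i)`, constant ONE) on the orbital integrand. [cite: Folland1995, §2.6 Thm. 2.49, (2.52)] [cite: Gelbart1975, p. 155 (10.19)] -/
theorem integral_pi_quotientMeasure_comp_descConj_id_eq {E : Type*} [NormedAddCommGroup E] [NormedSpace ℝ E] (F : (∀ i, G i) → E) :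
    ∫ p, F (fun i => descConj (γ i) (Subgroup.centralizer ({γ i} : Set (G i))) (fun _ hg => Subgroup.mem_centralizer_singleton_iff.1 hg) id (p i))
        ∂(Measure.pi fun i => quotientMeasure (Subgroup.centralizer ({γ i} : Set (G i))) (ρi i) (isClosed_coe_centralizer_singleton (γ i)) (ν i)) =
      ∫ x, descConj γ (Subgroup.pi Set.univ (fun i => Subgroup.centralizer ({γ i} : Set (G i)))) (mul_eq_mul_of_mem_pi_centralizer γ) F x
        ∂(quotientMeasure (Subgroup.pi Set.univ (fun i => Subgroup.centralizer ({γ i} : Set (G i)))) ρ (isClosed_coe_pi_centralizer γ) (Measure.pi ν)) := by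
  haveI : ∀ i, LocallyCompactSpace (Subgroup.centralizer ({γ i} : Set (G i))) := fun i =>
    (isClosed_coe_centralizer_singleton (γ i)).isClosedEmbedding_subtypeVal.locallyCompactSpace
  haveI : LocallyCompactSpace (Subgroup.pi Set.univ (fun i => Subgroup.centralizer ({γ i} : Set (G i)))) :=
    (isClosed_coe_pi_centralizer γ).isClosedEmbedding_subtypeVal.locallyCompactSpace
  rw [integral_quotientMeasure_pi_eq_integral_pi (fun i => Subgroup.centralizer ({γ i} : Set (G i)))
    (fun i => isClosed_coe_centralizer_singleton (γ i)) ρi ρ hρ ν]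
  simp_rw [coe_quotientPiHomeomorph_symm, descConj_pi_quotientPiEquiv_symm]

include hρ in
/-- **The same against the per-place ORBIT MEASURES** `μ_i := (ν_i∕ρ_i).map orbit_i` on `G_i` (p07's wall orbit measures): `∫_{Π G_i} F d(⊗_i μ_i) =
∫_{(Π G_i) ⧸ (Π Z(γ_i))} F(y γ y⁻¹) d((⨂ν_i)∕ρ)` (Mathlib `Measure.pi_map_pi`; the `μ_i` σ-finite, e.g. Radon on a σ-compact group).
[cite: Folland1995, §2.6 (2.52)] [cite: Rogawski1990, §8.2 p. 123] -/
theorem integral_pi_map_descConj_id_eq {E : Type*} [NormedAddCommGroup E] [NormedSpace ℝ E] (F : (∀ i, G i) → E)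
    [∀ i, SigmaFinite ((quotientMeasure (Subgroup.centralizer ({γ i} : Set (G i))) (ρi i) (isClosed_coe_centralizer_singleton (γ i)) (ν i)).map
      (descConj (γ i) (Subgroup.centralizer ({γ i} : Set (G i))) (fun _ hg => Subgroup.mem_centralizer_singleton_iff.1 hg) id))]
    (hF : AEStronglyMeasurable F (Measure.pi fun i =>
      (quotientMeasure (Subgroup.centralizer ({γ i} : Set (G i))) (ρi i) (isClosed_coe_centralizer_singleton (γ i)) (ν i)).map
        (descConj (γ i) (Subgroup.centralizer ({γ i} : Set (G i))) (fun _ hg => Subgroup.mem_centralizer_singleton_iff.1 hg) id))) :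
    ∫ g, F g ∂(Measure.pi fun i =>
        (quotientMeasure (Subgroup.centralizer ({γ i} : Set (G i))) (ρi i) (isClosed_coe_centralizer_singleton (γ i)) (ν i)).map
          (descConj (γ i) (Subgroup.centralizer ({γ i} : Set (G i))) (fun _ hg => Subgroup.mem_centralizer_singleton_iff.1 hg) id)) =
      ∫ x, descConj γ (Subgroup.pi Set.univ (fun i => Subgroup.centralizer ({γ i} : Set (G i)))) (mul_eq_mul_of_mem_pi_centralizer γ) F x
        ∂(quotientMeasure (Subgroup.pi Set.univ (fun i => Subgroup.centralizer ({γ i} : Set (G i)))) ρ (isClosed_coe_pi_centralizer γ) (Measure.pi ν)) := by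
  have hmeas : ∀ i, AEMeasurable
      (descConj (γ i) (Subgroup.centralizer ({γ i} : Set (G i))) (fun _ hg => Subgroup.mem_centralizer_singleton_iff.1 hg) id)
      (quotientMeasure (Subgroup.centralizer ({γ i} : Set (G i))) (ρi i) (isClosed_coe_centralizer_singleton (γ i)) (ν i)) :=
    fun i => (continuous_descConj_id (γ i) _ _).measurable.aemeasurable
  have hφ : AEMeasurable (fun (x : ∀ i, G i ⧸ Subgroup.centralizer ({γ i} : Set (G i))) (i : ι) =>
      descConj (γ i) (Subgroup.centralizer ({γ i} : Set (G i))) (fun _ hg => Subgroup.mem_centralizer_singleton_iff.1 hg) id (x i))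
      (Measure.pi fun i => quotientMeasure (Subgroup.centralizer ({γ i} : Set (G i))) (ρi i) (isClosed_coe_centralizer_singleton (γ i)) (ν i)) :=
    aemeasurable_pi_lambda _ fun i => (hmeas i).comp_quasiMeasurePreserving (Measure.quasiMeasurePreserving_eval _ i)
  rw [← Measure.pi_map_pi hmeas] at hF
  rw [← Measure.pi_map_pi hmeas, integral_map hφ hF]
  exact integral_pi_quotientMeasure_comp_descConj_id_eq γ ρi ρ hρ ν F

/-! ### Transport to an isomorphic group `G′ ≃ Π_i G_i` -/

variable {G' : Type*} [Group G'] [TopologicalSpace G'] [IsTopologicalGroup G'] [LocallyCompactSpace G'] [SecondCountableTopology G']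
  [T2Space G'] [MeasurableSpace G'] [BorelSpace G']
  [∀ γ' : G', MeasurableSpace (G' ⧸ Subgroup.centralizer ({γ'} : Set G'))]
  [∀ γ' : G', BorelSpace (G' ⧸ Subgroup.centralizer ({γ'} : Set G'))]
  (e : (∀ i, G i) ≃* G') (he : Continuous e) (hes : Continuous e.symm) {γ' : G'} (hγ : e γ = γ')
  (ν' : Measure G') [ν'.IsHaarMeasure] [ν'.IsMulRightInvariant]

include hρ in
/-- **… = AN ORBITAL INTEGRAL ON `G′ ≃ Π_i G_i`.**  For a bicontinuous isomorphism `e : Π_i G_i ≃* G′`, `γ′ = e γ`, a Haar measure `ν′` on `G′` whose pull-back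
is the product Haar measure (`ν′.map e.symm = ⨂ ν_i`), and the transported centraliser measure `ρ′ = (e|_{ΠZ})_* ρ` on `Z(γ′)`:
`∫_{Π_i (G_i ⧸ Z(γ_i))} f(e((y_i γ_i y_i⁻¹)_i)) d(⊗_i (ν_i∕ρ_i)) = O_{γ′}(f; ν′∕ρ′)` (★ (G2a)). [cite: Rogawski1990, §8.2 p. 123; §1.7 p. 6]
[cite: DeitmarEchterhoff2014, Thm. 1.5.3] [cite: Folland1995, §2.6 (2.52)] -/
theorem integral_pi_quotientMeasure_comp_descConj_id_eq_orbitalIntegral (hν' : ν'.map e.symm = Measure.pi ν)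
    (ρ' : Measure (Subgroup.centralizer ({γ'} : Set G'))) [ρ'.IsHaarMeasure] [ρ'.IsInvInvariant]
    (hρ' : ρ' = ρ.map (subgroupCongrHomeomorph e (Subgroup.pi Set.univ (fun i => Subgroup.centralizer ({γ i} : Set (G i))))
      (Subgroup.centralizer ({γ'} : Set G')) (apply_mem_centralizer_iff_mem_pi_centralizer γ e hγ) he hes))
    (f : G' → ℂ) :
    ∫ p, f (e (fun i => descConj (γ i) (Subgroup.centralizer ({γ i} : Set (G i))) (fun _ hg => Subgroup.mem_centralizer_singleton_iff.1 hg) id (p i)))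
        ∂(Measure.pi fun i => quotientMeasure (Subgroup.centralizer ({γ i} : Set (G i))) (ρi i) (isClosed_coe_centralizer_singleton (γ i)) (ν i)) =
      orbitalIntegral γ' f (quotientMeasure (Subgroup.centralizer ({γ'} : Set G')) ρ' (isClosed_coe_centralizer_singleton γ') ν') := by
  haveI h1 : (ν'.map e.symm).IsHaarMeasure := by rw [hν']; infer_instance
  haveI h2 : (ν'.map e.symm).IsMulRightInvariant := by rw [hν']; infer_instance
  rw [integral_pi_quotientMeasure_comp_descConj_id_eq γ ρi ρ hρ ν (fun y => f (e y))]
  have h := integral_descConj_quotientMeasure_map_symm_eq_orbitalIntegral e he hes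
    (Subgroup.pi Set.univ (fun i => Subgroup.centralizer ({γ i} : Set (G i)))) (isClosed_coe_pi_centralizer γ)
    (mul_eq_mul_of_mem_pi_centralizer γ) (apply_mem_centralizer_iff_mem_pi_centralizer γ e hγ) ρ ν' hγ ρ' hρ' f
  rw [← h]
  have key : ∀ (μ₁ μ₂ : Measure (∀ i, G i)) [μ₁.IsHaarMeasure] [μ₁.IsMulRightInvariant] [μ₂.IsHaarMeasure] [μ₂.IsMulRightInvariant], μ₁ = μ₂ →
      quotientMeasure (Subgroup.pi Set.univ (fun i => Subgroup.centralizer ({γ i} : Set (G i)))) ρ (isClosed_coe_pi_centralizer γ) μ₁ =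
        quotientMeasure (Subgroup.pi Set.univ (fun i => Subgroup.centralizer ({γ i} : Set (G i)))) ρ (isClosed_coe_pi_centralizer γ) μ₂ := by
    intro μ₁ μ₂ _ _ _ _ h12
    subst h12
    rfl
  rw [key (Measure.pi ν) (ν'.map e.symm) hν'.symm]


include hρ in
/-- **… = THE CLASS ORBITAL INTEGRAL OF ANY COMPATIBLE WEIL-FORM FAMILY on `G′`**: if `m.atPoint γ′ = ν′∕ρ′` (the `hq` binder: ★ p840955's ∃-PIN for the
letter's singular family + ★ Haar change), then `∫_{Π_i (G_i ⧸ Z(γ_i))} f(e((y_i γ_i y_i⁻¹)_i)) d(⊗_i (ν_i∕ρ_i)) = Φ(⟦γ′⟧, f; m)` (★ (G2b)).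
[cite: Rogawski1990, §8.2 p. 123; §4.3 (4.3.1) p. 43] [cite: DeitmarEchterhoff2014, Thm. 1.5.3] -/
theorem OrbitalMeasureFamily.integral_pi_quotientMeasure_comp_descConj_id_eq_classOrbitalIntegral_of_atPoint_eq
    (hν' : ν'.map e.symm = Measure.pi ν) (m : OrbitalMeasureFamily G')
    [SMulInvariantMeasure G' (G' ⧸ Subgroup.centralizer ({(Quotient.out (ConjClasses.mk γ') : G')} : Set G')) (m (ConjClasses.mk γ'))]
    (ρ' : Measure (Subgroup.centralizer ({γ'} : Set G'))) [ρ'.IsHaarMeasure] [ρ'.IsInvInvariant]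
    (hρ' : ρ' = ρ.map (subgroupCongrHomeomorph e (Subgroup.pi Set.univ (fun i => Subgroup.centralizer ({γ i} : Set (G i))))
      (Subgroup.centralizer ({γ'} : Set G')) (apply_mem_centralizer_iff_mem_pi_centralizer γ e hγ) he hes))
    (hq : m.atPoint γ' = quotientMeasure (Subgroup.centralizer ({γ'} : Set G')) ρ' (isClosed_coe_centralizer_singleton γ') ν')
    (f : G' → ℂ) :
    ∫ p, f (e (fun i => descConj (γ i) (Subgroup.centralizer ({γ i} : Set (G i))) (fun _ hg => Subgroup.mem_centralizer_singleton_iff.1 hg) id (p i)))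
        ∂(Measure.pi fun i => quotientMeasure (Subgroup.centralizer ({γ i} : Set (G i))) (ρi i) (isClosed_coe_centralizer_singleton (γ i)) (ν i)) =
      classOrbitalIntegral m f (ConjClasses.mk γ') := by
  rw [← m.orbitalIntegral_atPoint γ' f, hq]
  exact integral_pi_quotientMeasure_comp_descConj_id_eq_orbitalIntegral γ ρi ρ hρ ν e he hes hγ ν' hν' ρ' hρ' f

end PiOrbit

end Literature.MeasureTheory.Group

/-! ## §2 `G′_∞ = U(diag α)(L⁺ ⊗ ℝ) ≃ Π_w G_w`: the end state of the «method of §8.2» at the torus point `t(z)` -/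

namespace Literature.NumberTheory.Automorphic.UnitaryGroup

open Literature.MeasureTheory.Group _root_.NumberField _root_.NumberField.InfinitePlace _root_.Matrix
open scoped Classical

variable (L : Type) [Field L] [NumberField L] [IsCMField L] (N : ℕ) (α : Fin N → L)

/-- The torus point in product coordinates: `e⁻¹ (diag(z_w))_w = t(z)` for `e = archPiEquivCM` (★ `archPiEquivCM_archDiagTorus`). [cite: Rogawski1990, §4.9 p. 54] -/
theorem archPiEquivCM_symm_circleDiagonal_eq_archDiagTorus (z : {w : InfinitePlace L // IsComplex w} → Fin N → Circle) :
    (archPiEquivCM N L (Matrix.diagonal α)).symm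
        (fun w => (⟨circleDiagonal N (z w), circleDiagonal_mem_archLocal_diagonal L N α w (z w)⟩ : archLocal L N (Matrix.diagonal α) w)) =
      archDiagTorus L N α z := by
  rw [ContinuousMulEquiv.symm_apply_eq]
  exact (funext (archPiEquivCM_archDiagTorus L N α z)).symm

variable
  [MeasurableSpace (arch (↥(maximalRealSubfield L)) L (IsCMField.complexConj L) N (Matrix.diagonal α))]
  [BorelSpace (arch (↥(maximalRealSubfield L)) L (IsCMField.complexConj L) N (Matrix.diagonal α))]
  [∀ γ' : arch (↥(maximalRealSubfield L)) L (IsCMField.complexConj L) N (Matrix.diagonal α),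
    MeasurableSpace (arch (↥(maximalRealSubfield L)) L (IsCMField.complexConj L) N (Matrix.diagonal α) ⧸ Subgroup.centralizer ({γ'} : Set _))]
  [∀ γ' : arch (↥(maximalRealSubfield L)) L (IsCMField.complexConj L) N (Matrix.diagonal α),
    BorelSpace (arch (↥(maximalRealSubfield L)) L (IsCMField.complexConj L) N (Matrix.diagonal α) ⧸ Subgroup.centralizer ({γ'} : Set _))]
  [∀ w : {w : InfinitePlace L // IsComplex w}, MeasurableSpace (archLocal L N (Matrix.diagonal α) w)]
  [∀ w : {w : InfinitePlace L // IsComplex w}, BorelSpace (archLocal L N (Matrix.diagonal α) w)]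
  [∀ w : {w : InfinitePlace L // IsComplex w}, SecondCountableTopology (archLocal L N (Matrix.diagonal α) w)]
  [∀ w : {w : InfinitePlace L // IsComplex w}, LocallyCompactSpace (archLocal L N (Matrix.diagonal α) w)]
  (z : {w : InfinitePlace L // IsComplex w} → Fin N → Circle)
  [∀ w : {w : InfinitePlace L // IsComplex w}, MeasurableSpace (archLocal L N (Matrix.diagonal α) w ⧸
    Subgroup.centralizer ({(⟨circleDiagonal N (z w), circleDiagonal_mem_archLocal_diagonal L N α w (z w)⟩ : archLocal L N (Matrix.diagonal α) w)} : Set _))]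
  [∀ w : {w : InfinitePlace L // IsComplex w}, BorelSpace (archLocal L N (Matrix.diagonal α) w ⧸
    Subgroup.centralizer ({(⟨circleDiagonal N (z w), circleDiagonal_mem_archLocal_diagonal L N α w (z w)⟩ : archLocal L N (Matrix.diagonal α) w)} : Set _))]
  [MeasurableSpace ((∀ w : {w : InfinitePlace L // IsComplex w}, archLocal L N (Matrix.diagonal α) w) ⧸ Subgroup.pi Set.univ (fun w =>
    Subgroup.centralizer ({(⟨circleDiagonal N (z w), circleDiagonal_mem_archLocal_diagonal L N α w (z w)⟩ : archLocal L N (Matrix.diagonal α) w)} : Set _)))]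
  [BorelSpace ((∀ w : {w : InfinitePlace L // IsComplex w}, archLocal L N (Matrix.diagonal α) w) ⧸ Subgroup.pi Set.univ (fun w =>
    Subgroup.centralizer ({(⟨circleDiagonal N (z w), circleDiagonal_mem_archLocal_diagonal L N α w (z w)⟩ : archLocal L N (Matrix.diagonal α) w)} : Set _)))]
  (νw : ∀ w : {w : InfinitePlace L // IsComplex w}, Measure (archLocal L N (Matrix.diagonal α) w))
  [∀ w, (νw w).IsHaarMeasure] [∀ w, (νw w).IsMulRightInvariant]
  (ρw : ∀ w : {w : InfinitePlace L // IsComplex w}, Measure (Subgroup.centralizer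
    ({(⟨circleDiagonal N (z w), circleDiagonal_mem_archLocal_diagonal L N α w (z w)⟩ : archLocal L N (Matrix.diagonal α) w)} : Set _)))
  [∀ w, (ρw w).IsHaarMeasure] [∀ w, (ρw w).IsInvInvariant]
  (ρ : Measure (Subgroup.pi Set.univ (fun w : {w : InfinitePlace L // IsComplex w} => Subgroup.centralizer
    ({(⟨circleDiagonal N (z w), circleDiagonal_mem_archLocal_diagonal L N α w (z w)⟩ : archLocal L N (Matrix.diagonal α) w)} : Set _))))
  [ρ.IsHaarMeasure] [ρ.IsInvInvariant]
  (hρ : Measure.map (subgroupPiCoords fun w : {w : InfinitePlace L // IsComplex w} => Subgroup.centralizer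
    ({(⟨circleDiagonal N (z w), circleDiagonal_mem_archLocal_diagonal L N α w (z w)⟩ : archLocal L N (Matrix.diagonal α) w)} : Set _)) ρ = Measure.pi ρw)

include hρ in
/-- **(R1-c) THE END STATE IS AN ORBITAL INTEGRAL AT `t(z)`.**  With the (V7) product-measure convention `ν = e⁻¹_*(⊗_w ν_w)` on `G′_∞` and the
centraliser measure `ρ′ = (e⁻¹|_{Π Z_w})_* ρ` (`ρ ↔ ⊗_w ρ_w`) on `Z(t(z))`: the integral of `f` against the product of the per-place Weil-quotient orbit
integrals at the points `diag(z_w)` IS the orbital integral `O_{t(z)}(f; ν∕ρ′)` — at EVERY `z` (wall or not).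
[cite: Rogawski1990, §8.2 pp. 122–124; §14.5 p. 238; §1.7 p. 6] [cite: Folland1995, §2.6 (2.52)] [cite: DeitmarEchterhoff2014, Thm. 1.5.3] -/
theorem integral_pi_quotientMeasure_comp_conj_circleDiagonal_eq_orbitalIntegral_archDiagTorus
    [((Measure.pi νw).map (archPiEquivCM N L (Matrix.diagonal α)).symm).IsHaarMeasure]
    [((Measure.pi νw).map (archPiEquivCM N L (Matrix.diagonal α)).symm).IsMulRightInvariant]
    (ρ' : Measure (Subgroup.centralizer ({archDiagTorus L N α z} : Set (arch (↥(maximalRealSubfield L)) L (IsCMField.complexConj L) N (Matrix.diagonal α)))))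
    [ρ'.IsHaarMeasure] [ρ'.IsInvInvariant]
    (hρ' : ρ' = ρ.map (subgroupCongrHomeomorph (archPiEquivCM N L (Matrix.diagonal α)).symm.toMulEquiv
      (Subgroup.pi Set.univ (fun w : {w : InfinitePlace L // IsComplex w} => Subgroup.centralizer
        ({(⟨circleDiagonal N (z w), circleDiagonal_mem_archLocal_diagonal L N α w (z w)⟩ : archLocal L N (Matrix.diagonal α) w)} : Set _)))
      (Subgroup.centralizer ({archDiagTorus L N α z} : Set _))
      (apply_mem_centralizer_iff_mem_pi_centralizer _ (archPiEquivCM N L (Matrix.diagonal α)).symm.toMulEquiv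
        (archPiEquivCM_symm_circleDiagonal_eq_archDiagTorus L N α z))
      (archPiEquivCM N L (Matrix.diagonal α)).symm.continuous (archPiEquivCM N L (Matrix.diagonal α)).continuous))
    (f : arch (↥(maximalRealSubfield L)) L (IsCMField.complexConj L) N (Matrix.diagonal α) → ℂ) :
    ∫ p, f ((archPiEquivCM N L (Matrix.diagonal α)).symm (fun w =>
        descConj (⟨circleDiagonal N (z w), circleDiagonal_mem_archLocal_diagonal L N α w (z w)⟩ : archLocal L N (Matrix.diagonal α) w)
          (Subgroup.centralizer _) (fun _ hg => Subgroup.mem_centralizer_singleton_iff.1 hg) id (p w)))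
        ∂(Measure.pi fun w => quotientMeasure (Subgroup.centralizer _) (ρw w) (isClosed_coe_centralizer_singleton _) (νw w)) =
      orbitalIntegral (archDiagTorus L N α z) f
        (quotientMeasure (Subgroup.centralizer ({archDiagTorus L N α z} : Set _)) ρ' (isClosed_coe_centralizer_singleton _)
          ((Measure.pi νw).map (archPiEquivCM N L (Matrix.diagonal α)).symm)) := by
  have hν' : ((Measure.pi νw).map (archPiEquivCM N L (Matrix.diagonal α)).symm).map
      (archPiEquivCM N L (Matrix.diagonal α)).symm.toMulEquiv.symm = Measure.pi νw := by
    have h1 : Measurable (⇑((archPiEquivCM N L (Matrix.diagonal α)).symm.toMulEquiv.symm)) :=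
      (archPiEquivCM N L (Matrix.diagonal α)).continuous.measurable
    have h2 : Measurable (⇑((archPiEquivCM N L (Matrix.diagonal α)).symm)) :=
      (archPiEquivCM N L (Matrix.diagonal α)).symm.continuous.measurable
    rw [Measure.map_map h1 h2]
    have : (⇑((archPiEquivCM N L (Matrix.diagonal α)).symm.toMulEquiv.symm)) ∘ (⇑((archPiEquivCM N L (Matrix.diagonal α)).symm)) = id :=
      funext fun x => (archPiEquivCM N L (Matrix.diagonal α)).apply_symm_apply x
    rw [this, Measure.map_id]
  exact integral_pi_quotientMeasure_comp_descConj_id_eq_orbitalIntegral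
    (fun w => (⟨circleDiagonal N (z w), circleDiagonal_mem_archLocal_diagonal L N α w (z w)⟩ : archLocal L N (Matrix.diagonal α) w))
    ρw ρ hρ νw (archPiEquivCM N L (Matrix.diagonal α)).symm.toMulEquiv (archPiEquivCM N L (Matrix.diagonal α)).symm.continuous
    (archPiEquivCM N L (Matrix.diagonal α)).continuous (archPiEquivCM_symm_circleDiagonal_eq_archDiagTorus L N α z) _ hν' ρ' hρ' f

include hρ in
/-- **(R1-c) THE END STATE IS A CLASS ORBITAL INTEGRAL.**  For any orbital-measure family `m` on `G′_∞` in Weil form at `t(z)` for the (V7) measure,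
`m.atPoint t(z) = ν∕ρ′` (e.g. the letter's singular family: ★ p840955 `exists_atPoint_eq_quotientMeasure_of_isQuotientOf_singular` + ★ Haar change):
`∫ f(e⁻¹((y_w·diag(z_w)·y_w⁻¹)_w)) d(⊗_w (ν_w∕ρ_w)) = Φ(⟦t(z)⟧, f; m)` — p07's `Ψ_{I,ρ} = κ′ · classOrbitalIntegral m_S a ⟦t⁰_ρ⟧` with `κ′ = 1` for matched `ρ′`.
[cite: Rogawski1990, §8.2 pp. 122–124; §14.5 p. 238] [cite: DeitmarEchterhoff2014, Thm. 1.5.3] -/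
theorem integral_pi_quotientMeasure_comp_conj_circleDiagonal_eq_classOrbitalIntegral_archDiagTorus_of_atPoint_eq
    [((Measure.pi νw).map (archPiEquivCM N L (Matrix.diagonal α)).symm).IsHaarMeasure]
    [((Measure.pi νw).map (archPiEquivCM N L (Matrix.diagonal α)).symm).IsMulRightInvariant]
    (m : OrbitalMeasureFamily (arch (↥(maximalRealSubfield L)) L (IsCMField.complexConj L) N (Matrix.diagonal α)))
    [SMulInvariantMeasure (arch (↥(maximalRealSubfield L)) L (IsCMField.complexConj L) N (Matrix.diagonal α))
      (arch (↥(maximalRealSubfield L)) L (IsCMField.complexConj L) N (Matrix.diagonal α) ⧸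
        Subgroup.centralizer ({(Quotient.out (ConjClasses.mk (archDiagTorus L N α z)) : arch (↥(maximalRealSubfield L)) L (IsCMField.complexConj L) N (Matrix.diagonal α))} : Set _))
      (m (ConjClasses.mk (archDiagTorus L N α z)))]
    (ρ' : Measure (Subgroup.centralizer ({archDiagTorus L N α z} : Set (arch (↥(maximalRealSubfield L)) L (IsCMField.complexConj L) N (Matrix.diagonal α)))))
    [ρ'.IsHaarMeasure] [ρ'.IsInvInvariant]
    (hρ' : ρ' = ρ.map (subgroupCongrHomeomorph (archPiEquivCM N L (Matrix.diagonal α)).symm.toMulEquiv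
      (Subgroup.pi Set.univ (fun w : {w : InfinitePlace L // IsComplex w} => Subgroup.centralizer
        ({(⟨circleDiagonal N (z w), circleDiagonal_mem_archLocal_diagonal L N α w (z w)⟩ : archLocal L N (Matrix.diagonal α) w)} : Set _)))
      (Subgroup.centralizer ({archDiagTorus L N α z} : Set _))
      (apply_mem_centralizer_iff_mem_pi_centralizer _ (archPiEquivCM N L (Matrix.diagonal α)).symm.toMulEquiv
        (archPiEquivCM_symm_circleDiagonal_eq_archDiagTorus L N α z))
      (archPiEquivCM N L (Matrix.diagonal α)).symm.continuous (archPiEquivCM N L (Matrix.diagonal α)).continuous))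
    (hq : m.atPoint (archDiagTorus L N α z) =
      quotientMeasure (Subgroup.centralizer ({archDiagTorus L N α z} : Set _)) ρ' (isClosed_coe_centralizer_singleton _)
        ((Measure.pi νw).map (archPiEquivCM N L (Matrix.diagonal α)).symm))
    (f : arch (↥(maximalRealSubfield L)) L (IsCMField.complexConj L) N (Matrix.diagonal α) → ℂ) :
    ∫ p, f ((archPiEquivCM N L (Matrix.diagonal α)).symm (fun w =>
        descConj (⟨circleDiagonal N (z w), circleDiagonal_mem_archLocal_diagonal L N α w (z w)⟩ : archLocal L N (Matrix.diagonal α) w)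
          (Subgroup.centralizer _) (fun _ hg => Subgroup.mem_centralizer_singleton_iff.1 hg) id (p w)))
        ∂(Measure.pi fun w => quotientMeasure (Subgroup.centralizer _) (ρw w) (isClosed_coe_centralizer_singleton _) (νw w)) =
      classOrbitalIntegral m f (ConjClasses.mk (archDiagTorus L N α z)) := by
  rw [← m.orbitalIntegral_atPoint (archDiagTorus L N α z) f, hq]
  exact integral_pi_quotientMeasure_comp_conj_circleDiagonal_eq_orbitalIntegral_archDiagTorus L N α z νw ρw ρ hρ ρ' hρ' f

end Literature.NumberTheory.Automorphic.UnitaryGroup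

end
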